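import Summits.BirchSwinnertonDyer.Rank1Residual.P2.CubeSumLocalTypesAtThree
import Literature.NumberTheory.EllipticCurves.LocalEulerFactorModel
import Literature.NumberTheory.DiophantineGeometry.GeneralizedFermatTwoPowerCoefficientExponentThree
import HarnessLib

/-!
# The cube-sum curves `E_n : x³ + y³ = n`: the local type of EVERY model at the places over `2` and
# over `p ≥ 5`, for every cube-free `n`, by Tate's algorithm run in the kernel

Cell `bsd-print-cf2`, seat ty2, line `route-BirchSwinnertonDyer-CMKolyvaginAtInertTwo` (leaf
`WAllCornerFTwo`; items 22835/22836, residual 22838). HONEST FRAMING: THEOREMS ONLY — no definition, no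
named fact, no route file imported, nothing about BSD asserted or booked; the leaf is OPEN. Companion of
`CubeSumLocalTypesAtThree.lean` (the place `3`); consumed by `CMKolyvaginHabitatTamagawaCubeSums.lean`
(the parity of `∏ c_ℓ(E_n)`, the habitat's Tamagawa binder).

## What is here (`n ∈ ℤ ∖ {0}` cube-free; `B` any model, `∃ C, C • B = cubeSumCurve n`)

* §1 the places over `p ≥ 5` (x1b's engine via `X12.CMRamifiedRecords.hasGoodReductionAt_or_kodairaSymbolAt_of_mordell`
  on `k = −432n²`, `v_p(k) = 2v_p(n)`): **good if `p ∤ n`, `IV` if `p ∥ n`, `IV*` if `p² ∥ n`**.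
* §3 the place over `2`: **good if `n` is odd** (the integral model `[0, 0, n, 0, −7n²]` has odd
  discriminant `−3⁹n⁴`); **`IV` or `IV*` if `2 ∥ n` or `4 ∥ n`** (rescaled by `u = 2` the equation is
  `y² = x³ − 27m²` resp. `− 108m²` with `−27m² ≡ 1 (mod 4)`: the IV-rows of the tree's `2`-adic table
  `X12.CMRamifiedRecords.kodairaSymbolAt_two_of_mordell` / `MordellCurveTateAlgorithmTwoProofs`).

So at every place `ℓ ≠ 3` a cube-free `E_n` is good or of type IV / IV* (component group of order `1`
or `3`): the `2`-part of `∏ c_ℓ(E_n)` lives at `3` alone. Numerical cross-check (EVIDENCE, not used):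
kit j293806 (PARI, cube-free `n ≤ 400`).

References: J. H. Silverman, *ATAEC* IV.9.4 and Table 4.1 [SilvermanATAEC1994]; *AEC* VII.1 Rem. 1.1,
VII.5.1 [SilvermanAEC2009]; Hu–Shu–Yin 2019 p. 4 [HuShuYin2019].
-/

set_option autoImplicit false

noncomputable section

open scoped Classical NumberField

open WeierstrassCurve NumberField IsDedekindDomain IsDedekindDomain.HeightOneSpectrum
  Rat.HeightOneSpectrum Literature.NumberTheory.EllipticCurves
  Literature.NumberTheory.EllipticCurves.HuShuYin2019
  Literature.NumberTheory.DiophantineGeometry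
  Literature.NumberTheory.GaloisRepresentations
  Summit.BirchSwinnertonDyer.Rank1Residual.X12.CMRamifiedRecords

namespace Summit.BirchSwinnertonDyer.Rank1Residual.P2.CubeSum

/-! ## §1 The places over `p ≥ 5`: good if `p ∤ n`, type `IV` if `p ∥ n`, type `IV*` if `p² ∥ n` -/

section OddPrime

variable {n : ℤ} (B : WeierstrassCurve ℚ) [B.IsElliptic] (v : HeightOneSpectrum (𝓞 ℚ))

omit [B.IsElliptic] in
/-- A model `B ≅ E_n` is `C • B = (y² = x³ − 432n²)` with integer coefficient. [folklore] -/
theorem exists_smul_eq_mordell (hB : ∃ C : VariableChange ℚ, C • B = cubeSumCurve (n : ℚ)) :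
    ∃ C : VariableChange ℚ, C • B = ⟨0, 0, 0, 0, ((-432 * n ^ 2 : ℤ) : ℚ)⟩ := by
  obtain ⟨C, hC⟩ := hB
  exact ⟨C, by rw [hC, cubeSumCurve_eq_mordell]⟩

/-- **`E_n` at `p ≥ 5`, `p ∤ n`: good reduction** (every model; `v_p(432n²) = 0`).
[cite: SilvermanATAEC1994, IV.9.4 and Table 4.1] [cite: SilvermanAEC2009, VII.1 Remark 1.1] -/
theorem hasGoodReductionAt_of_model_of_not_dvd (hn : n ≠ 0)
    (hB : ∃ C : VariableChange ℚ, C • B = cubeSumCurve (n : ℚ)) (hv5 : 5 ≤ natGenerator v)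
    (hpn : ¬ (natGenerator v : ℤ) ∣ n) : B.HasGoodReductionAt v := by
  obtain ⟨C, hC⟩ := exists_smul_eq_mordell B hB
  have hp : (natGenerator v).Prime := prime_natGenerator v
  have h0 : n.natAbs.factorization (natGenerator v) = 0 :=
    Nat.factorization_eq_zero_of_not_dvd fun h => hpn (Int.natCast_dvd.mpr h)
  refine (hasGoodReductionAt_or_kodairaSymbolAt_of_mordell B v hC (mordellCoeff_ne_zero hn)
    (by omega) (by omega)).1 ?_
  rw [factorization_mordellCoeff hn hp hv5, h0]

/-- **`E_n` at `p ≥ 5` with `v_p(n) = 1`: Kodaira type `IV`** (every model; `v_p(432n²) = 2`,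
Tate's algorithm Step 5). [cite: SilvermanATAEC1994, IV.9.4 Step 5 and Table 4.1] -/
theorem kodairaSymbolAt_of_model_of_factorization_eq_one (hn : n ≠ 0)
    (hB : ∃ C : VariableChange ℚ, C • B = cubeSumCurve (n : ℚ)) (hv5 : 5 ≤ natGenerator v)
    (he : n.natAbs.factorization (natGenerator v) = 1) : B.kodairaSymbolAt v = .IV := by
  obtain ⟨C, hC⟩ := exists_smul_eq_mordell B hB
  have hp : (natGenerator v).Prime := prime_natGenerator v
  have h := (hasGoodReductionAt_or_kodairaSymbolAt_of_mordell B v hC (mordellCoeff_ne_zero hn)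
    (by omega) (by omega)).2
  rw [factorization_mordellCoeff hn hp hv5, he] at h
  exact h (by norm_num)

/-- **`E_n` at `p ≥ 5` with `v_p(n) = 2`: Kodaira type `IV*`** (every model; `v_p(432n²) = 4`,
Tate's algorithm Step 8). [cite: SilvermanATAEC1994, IV.9.4 Step 8 and Table 4.1] -/
theorem kodairaSymbolAt_of_model_of_factorization_eq_two (hn : n ≠ 0)
    (hB : ∃ C : VariableChange ℚ, C • B = cubeSumCurve (n : ℚ)) (hv5 : 5 ≤ natGenerator v)
    (he : n.natAbs.factorization (natGenerator v) = 2) : B.kodairaSymbolAt v = .IVstar := by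
  obtain ⟨C, hC⟩ := exists_smul_eq_mordell B hB
  have hp : (natGenerator v).Prime := prime_natGenerator v
  have h := (hasGoodReductionAt_or_kodairaSymbolAt_of_mordell B v hC (mordellCoeff_ne_zero hn)
    (by omega) (by omega)).2
  rw [factorization_mordellCoeff hn hp hv5, he] at h
  exact h (by norm_num)

/-- **`E_n` at `p ≥ 5`, `n` cube-free: good, or Kodaira type `IV`, or `IV*`** (every model).
[cite: SilvermanATAEC1994, IV.9.4 and Table 4.1] -/
theorem hasGoodReductionAt_or_kodairaSymbolAt_of_model_of_cubefree (hn : n ≠ 0)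
    (hcf : ∀ p : ℕ, p.Prime → ¬ (p : ℤ) ^ 3 ∣ n)
    (hB : ∃ C : VariableChange ℚ, C • B = cubeSumCurve (n : ℚ)) (hv5 : 5 ≤ natGenerator v) :
    B.HasGoodReductionAt v ∨ B.kodairaSymbolAt v = .IV ∨ B.kodairaSymbolAt v = .IVstar := by
  have hp : (natGenerator v).Prime := prime_natGenerator v
  have hle := factorization_le_two_of_cubefree hcf hp
  rcases Nat.lt_or_ge (n.natAbs.factorization (natGenerator v)) 1 with h0 | h1
  · refine Or.inl (hasGoodReductionAt_of_model_of_not_dvd B v hn hB hv5 fun h => ?_)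
    have : 1 ≤ n.natAbs.factorization (natGenerator v) :=
      (hp.pow_dvd_iff_le_factorization (Int.natAbs_ne_zero.mpr hn)).mp
        (by simpa using Int.natCast_dvd.mp h)
    omega
  · rcases Nat.eq_or_lt_of_le h1 with h1 | h2
    · exact Or.inr (Or.inl (kodairaSymbolAt_of_model_of_factorization_eq_one B v hn hB hv5 h1.symm))
    · exact Or.inr (Or.inr
        (kodairaSymbolAt_of_model_of_factorization_eq_two B v hn hB hv5 (by omega)))

end OddPrime

/-! ## §3 The place over `2`: good for `n` odd; type `IV` or `IV*` for `2 ∥ n` or `4 ∥ n` -/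

section Two

variable {n : ℤ} (B : WeierstrassCurve ℚ) [B.IsElliptic] (v : HeightOneSpectrum (𝓞 ℚ))

/-- The model `[0, 0, n, 0, −7n²]` of `E_n` (the one which is minimal at `2` for `n` odd) becomes
`y² = x³ − 432n²` under `u = ½`, `t = −n/2`. [folklore] -/
theorem halfScaleShift_smul (n : ℤ) :
    (⟨⟨(1 / 2 : ℚ), 2, by norm_num, by norm_num⟩, 0, 0, -(n : ℚ) / 2⟩ : VariableChange ℚ) •
      (⟨0, 0, (n : ℚ), 0, -7 * (n : ℚ) ^ 2⟩ : WeierstrassCurve ℚ) = cubeSumCurve (n : ℚ) := by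
  ext <;> simp [cubeSumCurve, WeierstrassCurve.variableChange_a₁,
    WeierstrassCurve.variableChange_a₂, WeierstrassCurve.variableChange_a₃,
    WeierstrassCurve.variableChange_a₄, WeierstrassCurve.variableChange_a₆] <;> ring

/-- `Δ[0, 0, n, 0, −7n²] = −3⁹n⁴`. [cite: SilvermanAEC2009, III.1] -/
theorem Δ_oddModel (n : ℤ) :
    (⟨0, 0, (n : ℚ), 0, -7 * (n : ℚ) ^ 2⟩ : WeierstrassCurve ℚ).Δ = ((-19683 * n ^ 4 : ℤ) : ℚ) := by
  simp only [WeierstrassCurve.Δ, WeierstrassCurve.b₂, WeierstrassCurve.b₄, WeierstrassCurve.b₆,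
    WeierstrassCurve.b₈]
  push_cast; ring

omit [B.IsElliptic] in
/-- **`E_n` at `2`, `n` odd: good reduction** (every model): the integral model `[0, 0, n, 0, −7n²]`
has odd discriminant `−3⁹n⁴`. [cite: SilvermanAEC2009, VII.1 Remark 1.1 and Prop. VII.5.1 (a)] -/
theorem hasGoodReductionAt_two_of_model_of_odd (hodd : Odd n)
    (hB : ∃ C : VariableChange ℚ, C • B = cubeSumCurve (n : ℚ)) (hv : natGenerator v = 2) :
    B.HasGoodReductionAt v := by
  obtain ⟨C, hC⟩ := hB
  set D : VariableChange ℚ := ⟨⟨(1 / 2 : ℚ), 2, by norm_num, by norm_num⟩, 0, 0, -(n : ℚ) / 2⟩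
    with hD
  set M : WeierstrassCurve ℚ := ⟨0, 0, (n : ℚ), 0, -7 * (n : ℚ) ^ 2⟩ with hMdef
  have hMB : M = (D⁻¹ * C) • B := by
    rw [mul_smul, hC, ← halfScaleShift_smul n, ← hD, inv_smul_smul]
  have hint : M.IsIntegralAt v :=
    M.isIntegralAt_of_valuation_le_one v (by simp [hMdef]) (by simp [hMdef])
      (Rat.valuation_intCast_le_one v n) (by simp [hMdef])
      (by rw [show M.a₆ = ((-7 * n ^ 2 : ℤ) : ℚ) by simp [hMdef]]; exact Rat.valuation_intCast_le_one v _)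
  have hΔodd : ¬ (natGenerator v : ℤ) ∣ (-19683 * n ^ 4 : ℤ) := by
    rw [hv]
    rintro h
    rcases (Int.prime_two.dvd_mul).mp (by exact_mod_cast h : (2 : ℤ) ∣ -19683 * n ^ 4) with h | h
    · norm_num at h
    · exact (Int.not_even_iff_odd.mpr hodd) (even_iff_two_dvd.mpr (Int.prime_two.dvd_of_dvd_pow h))
  have hΔ1 : v.valuation ℚ M.Δ = 1 := by
    rw [Δ_oddModel]; exact Rat.valuation_intCast_eq_one v hΔodd
  have hmin : M.IsMinimalAt v := isMinimalAt_of_lt_valuation_Δ_holds hint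
    (by rw [hΔ1, ← WithZero.exp_zero]; exact WithZero.exp_lt_exp.mpr (by norm_num))
  have hgood := (hasGoodReductionAt_iff_of_isMinimalAt (v := v) (W := M) hmin).mpr hΔ1
  rw [hMB] at hgood
  exact (hasGoodReductionAt_smul_iff_holds v B _).mp hgood

/-- Rescaling `y² = x³ − 432n²` by `u = 2`: for `n = 2m` the coefficient becomes `−27m²`, for `n = 4m`
it becomes `−108m²`. [folklore] -/
theorem twoScale_smul_cubeSumCurve (n : ℚ) :
    (⟨Units.mk0 (2 : ℚ) two_ne_zero, 0, 0, 0⟩ : VariableChange ℚ) • cubeSumCurve n =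
      ⟨0, 0, 0, 0, -27 * (n / 2) ^ 2⟩ := by
  rw [cubeSumCurve, Summit.BirchSwinnertonDyer.Rank1Residual.X12.smul_cubic_scale]
  congr 1
  rw [Units.val_inv_eq_inv_val, Units.val_mk0]; ring

/-- `−27m² ≡ 1 (mod 4)` for `m` odd. [folklore] -/
theorem neg_twentySeven_mul_sq_emod_four {m : ℤ} (hm : Odd m) : (-27 * m ^ 2) % 4 = 1 := by
  obtain ⟨j, rfl⟩ := hm
  rw [show -27 * (2 * j + 1) ^ 2 = 1 + 4 * (-27 * j ^ 2 - 27 * j - 7) by ring,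
    Int.add_mul_emod_self_left]
  rfl

/-- `v₂(27m²) = 0` for `m` odd. [folklore] -/
theorem factorization_two_twentySeven_mul_sq {m : ℤ} (hm : Odd m) :
    (-27 * m ^ 2 : ℤ).natAbs.factorization 2 = 0 := by
  refine Nat.factorization_eq_zero_of_not_dvd fun h => ?_
  have h' : (2 : ℤ) ∣ -27 * m ^ 2 := Int.natCast_dvd.mpr h
  rcases (Int.prime_two.dvd_mul).mp h' with h | h
  · norm_num at h
  · exact (Int.not_even_iff_odd.mpr hm) (even_iff_two_dvd.mpr (Int.prime_two.dvd_of_dvd_pow h))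

/-- `2 ∤ 27m²` for `m` odd. [folklore] -/
theorem not_two_dvd_twentySeven_mul_sq {m : ℤ} (hm : Odd m) : ¬ (2 : ℤ) ∣ -27 * m ^ 2 := by
  intro h2
  rcases (Int.prime_two.dvd_mul).mp h2 with h | h
  · norm_num at h
  · exact (Int.not_even_iff_odd.mpr hm) (even_iff_two_dvd.mpr (Int.prime_two.dvd_of_dvd_pow h))

/-- `v₂(108m²) = 2` for `m` odd. [folklore] -/
theorem factorization_two_oneOhEight_mul_sq {m : ℤ} (hm : Odd m) :
    (-108 * m ^ 2 : ℤ).natAbs.factorization 2 = 2 := by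
  have h1 : (-108 * m ^ 2 : ℤ).natAbs = 2 ^ 2 * (-27 * m ^ 2 : ℤ).natAbs := by
    simp only [Int.natAbs_mul, Int.natAbs_neg, Int.natAbs_pow]; norm_num; ring
  rw [h1, Nat.factorization_mul (by norm_num) (Int.natAbs_ne_zero.mpr
    (mul_ne_zero (by norm_num) (pow_ne_zero _ (ne_zero_of_odd hm)))), Finsupp.add_apply,
    factorization_two_twentySeven_mul_sq hm, Nat.factorization_pow, Finsupp.smul_apply,
    Nat.prime_two.factorization_self]
  rfl

/-- **`E_{2m}` at `2`, `m` odd: Kodaira type `IV` or `IV*`** (every model): rescaled by `u = 2` the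
equation is `y² = x³ − 27m²` with `−27m² ≡ 1 (mod 4)`, the `IV`-rows of the tree's `2`-adic table for
`y² = x³ + k`. [cite: SilvermanATAEC1994, IV.9.4 (PDF pp. 344–346) and Table 4.1] -/
theorem kodairaSymbolAt_two_of_model_of_two_mul {m : ℤ} (hm : Odd m)
    (hB : ∃ C : VariableChange ℚ, C • B = cubeSumCurve ((2 * m : ℤ) : ℚ)) (hv : natGenerator v = 2) :
    B.kodairaSymbolAt v = .IV ∨ B.kodairaSymbolAt v = .IVstar := by
  obtain ⟨C, hC⟩ := hB
  have hM : ((⟨Units.mk0 (2 : ℚ) two_ne_zero, 0, 0, 0⟩ : VariableChange ℚ) * C) • B =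
      ⟨0, 0, 0, 0, ((-27 * m ^ 2 : ℤ) : ℚ)⟩ := by
    rw [mul_smul, hC, twoScale_smul_cubeSumCurve]; congr 1; push_cast; ring
  have hk : (-27 * m ^ 2 : ℤ) ≠ 0 := mul_ne_zero (by norm_num) (pow_ne_zero _ (ne_zero_of_odd hm))
  have h64 : ¬ (64 : ℤ) ∣ -27 * m ^ 2 := fun h =>
    not_two_dvd_twentySeven_mul_sq hm ((show (2 : ℤ) ∣ 64 by norm_num).trans h)
  refine (kodairaSymbolAt_two_of_mordell B v hM hk h64 hv).1 ?_
  rw [factorization_two_twentySeven_mul_sq hm, twoAdicIVBit, if_pos]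
  exact ⟨Or.inl rfl, by rw [pow_zero, Int.ediv_one]; exact neg_twentySeven_mul_sq_emod_four hm⟩

/-- **`E_{4m}` at `2`, `m` odd: Kodaira type `IV` or `IV*`** (every model): rescaled by `u = 2` the
equation is `y² = x³ − 108m²`, `−108m²/4 = −27m² ≡ 1 (mod 4)`, the `IV*`-rows of the tree's `2`-adic
table. [cite: SilvermanATAEC1994, IV.9.4 (PDF pp. 344–346) and Table 4.1] -/
theorem kodairaSymbolAt_two_of_model_of_four_mul {m : ℤ} (hm : Odd m)
    (hB : ∃ C : VariableChange ℚ, C • B = cubeSumCurve ((4 * m : ℤ) : ℚ)) (hv : natGenerator v = 2) :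
    B.kodairaSymbolAt v = .IV ∨ B.kodairaSymbolAt v = .IVstar := by
  obtain ⟨C, hC⟩ := hB
  have hM : ((⟨Units.mk0 (2 : ℚ) two_ne_zero, 0, 0, 0⟩ : VariableChange ℚ) * C) • B =
      ⟨0, 0, 0, 0, ((-108 * m ^ 2 : ℤ) : ℚ)⟩ := by
    rw [mul_smul, hC, twoScale_smul_cubeSumCurve]; congr 1; push_cast; ring
  have hk : (-108 * m ^ 2 : ℤ) ≠ 0 := mul_ne_zero (by norm_num) (pow_ne_zero _ (ne_zero_of_odd hm))
  have h64 : ¬ (64 : ℤ) ∣ -108 * m ^ 2 := fun h => by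
    have h' : (16 : ℤ) * 4 ∣ 4 * (-27 * m ^ 2) := by
      rw [show (4 : ℤ) * (-27 * m ^ 2) = -108 * m ^ 2 by ring]; exact (by norm_num : (16 : ℤ) * 4 = 64) ▸ h
    rw [mul_comm (16 : ℤ) 4] at h'
    have h'' := (mul_dvd_mul_iff_left (by norm_num : (4 : ℤ) ≠ 0)).mp h'
    exact not_two_dvd_twentySeven_mul_sq hm ((show (2 : ℤ) ∣ 16 by norm_num).trans h'')
  refine (kodairaSymbolAt_two_of_mordell B v hM hk h64 hv).1 ?_
  rw [factorization_two_oneOhEight_mul_sq hm, twoAdicIVBit, if_pos]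
  refine ⟨Or.inr rfl, ?_⟩
  rw [show (-108 * m ^ 2 : ℤ) = 2 ^ 2 * (-27 * m ^ 2) by ring,
    Int.mul_ediv_cancel_left _ (pow_ne_zero _ two_ne_zero)]
  exact neg_twentySeven_mul_sq_emod_four hm

/-- **`E_n` at `2`, `n` cube-free: good (`n` odd), or Kodaira type `IV` or `IV*` (`2 ∥ n` or `4 ∥ n`)**
(every model). [cite: SilvermanATAEC1994, IV.9.4 and Table 4.1] [cite: SilvermanAEC2009, VII.1 Remark 1.1] -/
theorem hasGoodReductionAt_or_kodairaSymbolAt_two_of_model_of_cubefree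
    (hcf : ∀ p : ℕ, p.Prime → ¬ (p : ℤ) ^ 3 ∣ n)
    (hB : ∃ C : VariableChange ℚ, C • B = cubeSumCurve (n : ℚ)) (hv : natGenerator v = 2) :
    B.HasGoodReductionAt v ∨ B.kodairaSymbolAt v = .IV ∨ B.kodairaSymbolAt v = .IVstar := by
  have h8 : ¬ (8 : ℤ) ∣ n := fun h => hcf 2 Nat.prime_two (by norm_num; exact h)
  rcases Int.even_or_odd n with ⟨k, hk⟩ | hodd
  · rcases Int.even_or_odd k with ⟨j, hj⟩ | hkodd
    · have hj4 : n = 4 * j := by rw [hk, hj]; ring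
      have hjodd : Odd j := by
        rcases Int.even_or_odd j with ⟨i, hi⟩ | hjodd
        · exact absurd ⟨i, by rw [hj4, hi]; ring⟩ h8
        · exact hjodd
      subst hj4
      exact Or.inr (kodairaSymbolAt_two_of_model_of_four_mul B v hjodd hB hv)
    · have hk2 : n = 2 * k := by rw [hk]; ring
      subst hk2
      exact Or.inr (kodairaSymbolAt_two_of_model_of_two_mul B v hkodd hB hv)
  · exact Or.inl (hasGoodReductionAt_two_of_model_of_odd B v hodd hB hv)

end Two

end Summit.BirchSwinnertonDyer.Rank1Residual.P2.CubeSum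

end
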